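import Summits.QuantumFields.YangMills.Theorems.BalabanUVNodesN21ThresholdMixtureSibling

/-!
# YM-DAG node N21 (= NE7c) — THE THRESHOLD MIXTURE, PART 4: THE COMMON BOX.  A class-relative SHARP sibling bound, uniform over ONE
# threshold multiplier per OCCURRENCE, transfers to the (η) face's `SiblingSuppression` — the located remainder of file 9 typed

Track A of `YM-PLAN.md` (cell `pub-ymgap`, HUMAN RULING D-0062), node **N21**; R141 (C) fan-out seat `pub-ymgap-dag-n21-e` (s3 = ALTERNATIVE
CURRENCY), generation 3, file 10a.  Companions: 5a `…N21ThresholdMixture` (p466893: `integral_sum_le_of_forall`, `relBound_mixture_of_forall`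
— the LINEAR step, one space), 5b `…N21ThresholdMixtureRepr` (p467851: `integrable_sharpIntegrand`), 6 ∕ 8 `…N21AtSpineCarriersMixture(TwoThresholds)`
(p468321 ∕ p470362: the (η) faces, N20 in-edge `SiblingSuppression … (sibW (linProfile ∘ κ) …) Ssup`), 9 `…N21ThresholdMixtureSibling` (p472520:
`sibW_eq_sharpMixture` + its header CAVEAT, typed HERE).  Kernel bookkeeping + marginalisation of a finite product measure: 0 `def`, 0 `sorry`,
standard axioms.  COUNT-NEUTRAL; `--supports` the K3′ item `SpineGivenEndpointR12` as a helper.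

THE POINT.  File 9 identified the (η) face's realized sibling weight `sibW (linProfile ∘ κ) … σ K t τ` with the normalised average, over the
term's OWN threshold box `⊗_{j<m} Leb|[(1 − κ_{a_j})θ_j, θ_j]`, of a SHARP sibling weight (band at the nominal threshold × the term's other
characteristic functions SHARP × the threshold-free remainder) — and LOCATED the remainder: `SiblingSuppression` is CLASS-relative
(`Σ_τ sibW σ K t τ ≤ S(a)·Σ_τ X K t τ`), per-term domination is false, so a sharp class-relative bound can only be transported to the averages on
ONE COMMON PRODUCT SPACE over all OCCURRENCES of background-mediated characteristic functions of the step (lens (O-mix-3′): one multiplier per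
occurrence, shared by every term reading it), each term reading the sub-vector of its own occurrences.  This file supplies exactly that:
§1 the MARGINAL of a finite product measure `⊗_c ν_c` along an INJECTIVE coordinate map `e : J → C` is `(∏_{c ∉ e(J)} ν_c(univ)) • ⊗_j ν_{e j}`
(`pi_map_proj_eq_smul_pi`; Mathlib's `Measure.pi_map_eval` is the one-coordinate case, the tree's `…TorusLowerAxis.pi_map_proj_eq_pi` the
iid-probability case — heterogeneous finite version, same rectangle computation); §2 hence NORMALISED box averages agree along the projection
(`average_comp_proj_pi`); §3 a class-relative linear bound between two families of sharp weights holding at almost every COMMON threshold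
vector passes to the sums of the normalised per-term averages (`sum_average_le_sum_of_forall_proj`); §4 **`siblingSuppression_of_sharpCommonBox`**:
given per step `K` an occurrence list (`nC K` occurrences, occurrence `c` of age `aC K c` and nominal threshold `θC K c > 0`), each term's
INJECTIVE coordinate map `e K τ : Fin (m K τ) → Fin (nC K)` consistent with its slots and thresholds, the run's sharp weights `Xs` and sharp
sibling weights `Sbs` (file 6's ∕ file 9's letters) and the carriers `X` pinned as the normalised threshold averages — IF the sharp class-relative
sibling bound `Σ_{τ ∈ T K} Sbs σ K t τ (S ∘ e K τ) ≤ Ssup(a)·Σ_{τ ∈ T K} Xs K t τ (S ∘ e K τ)` holds for EVERY threshold assignment `S` in the common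
box `∏_c [(1 − κ_{aC c})θC_c, θC_c]`, THEN `SiblingSuppression l₀ T X N n (sibW (fun a => linProfile (κ a)) κ μ m slot pol θ uX RX ρ) Ssup` — the
N20 in-edge of files 6 ∕ 8 in print's OWN currency (sharp characteristic functions at admissibly placed thresholds).

HONEST FRAMING.  NE7c is NOT PRINTED and NOT PROVED.  The sharp uniform sibling bound `hsharp` is N20's (NE7b species: the small factor
`exp(−p₀(g))` per created large-field region, [Balaban1989LargeFieldII] (1.79) p. 383, for the band `[(1 − κ − ρ)θ, θ)` which is a same-run
large-field event at a lowered threshold, [Balaban1989LargeFieldI] p. 193) — DISPLAYED here, not discharged; it is asked UNIFORMLY over the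
common box, which is `T4LipschitzCutoff` §5∕§7's worst case.  The mixture remains a convex combination of print's SHARP procedure over admissible
threshold vectors — NOT print verbatim; (M1) for the deterministic sharp procedure is NOT claimed; N20 ∕ N16 ∕ NODE O untouched; N21 NOT
discharged; count-neutral; one finite four-torus programme at fixed `ε`; NOT continuum ∕ ℝ⁴ ∕ OS ∕ mass gap ∕ Clay.

CITATION HEADER (lean-in-tree rule 2026-08-18).  BY NAME from the tree: `T4LipschitzCutoff.SiblingSuppression` (:593) ∕ `linProfile` ∕ `sibling`;
`T4LipschitzLedger.Pol` ∕ `Pol.fac` ∕ `Pol.shell` ∕ `Pol.measurable_shell` ∕ `Pol.shell_nonneg` ∕ `Pol.shell_le_one` ∕ `sibW`; `T4IndicatorShell.smallInd`;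
file 5a `integral_sum_le_of_forall` (shape; two-family version re-proved in three lines here); file 5b `integrable_sharpIntegrand`; file 9
`integrable_sharpSiblingIntegrand`, `sibW_eq_sharpMixture`; Mathlib `Measure.pi_pi`, `Measure.map_apply`, `ext_of_generate_finite`,
`generateFrom_pi`, `isPiSystem_pi`, `Measure.restrict_pi_pi`, `integral_map`, `integral_smul_measure`, `Integrable.comp_measurable`,
`Finset.prod_mul_prod_compl`, `Finset.prod_image`.  Pattern credit: `Summit.….FemtoCurvatureTwoPointC.TorusGauge.pi_map_proj_eq_pi` (iid probability
version; not imported).  Context only (SHAPE): [Balaban1988Convergent] (2.17)∕(2.18) p. 257; [Balaban1989LargeFieldI] p. 193.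

WHAT IS PROVED ([folklore]).  §1 `measurable_proj`, `preimage_proj_univ_pi`, `pi_apply_preimage_proj`, **`pi_map_proj_eq_smul_pi`** · §2
`integral_comp_proj_pi`, `average_comp_proj_pi` · §3 `integrable_comp_proj_pi`, `integral_sum_le_sum_of_forall`, **`sum_average_le_sum_of_forall_proj`**
· §4 `ae_mem_box_pi`, `integrable_Xs_box`, `integrable_Sbs_box`, **`siblingSuppression_of_sharpCommonBox`**.
-/

set_option autoImplicit false

noncomputable section

open MeasureTheory Set
open scoped BigOperators ENNReal

namespace Summit.QuantumFields.YangMills.Theorems.N21ThresholdMixtureCommonBox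

open Literature.MathematicalPhysics.QuantumFieldTheory.Balaban1983to89
open Literature.MathematicalPhysics.QuantumFieldTheory.Balaban1983to89.T4LipschitzCutoff
open Literature.MathematicalPhysics.QuantumFieldTheory.Balaban1983to89.T4IndicatorShell
open Literature.MathematicalPhysics.QuantumFieldTheory.Balaban1983to89.T4LipschitzLedger
open N21ThresholdMixtureRepr (integrable_sharpIntegrand)
open N21ThresholdMixtureSibling (integrable_sharpSiblingIntegrand sibW_eq_sharpMixture)

/-! ## §1 The marginal of a finite product measure along an injective coordinate map -/

section Proj

variable {α : Type*} {C J : Type*}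

/-- reading the coordinates `e j` of a vector is measurable. [folklore] -/
theorem measurable_proj [MeasurableSpace α] (e : J → C) : Measurable fun (s : C → α) (j : J) => s (e j) :=
  measurable_pi_lambda _ fun j => measurable_pi_apply (e j)

/-- the preimage of a rectangle under the coordinate projection along `e` is the rectangle whose `c`-side collects the constraints of all
`j` with `e j = c` (so `univ` off the range of `e`). [folklore] -/
theorem preimage_proj_univ_pi (e : J → C) (t : J → Set α) :
    (fun (s : C → α) (j : J) => s (e j)) ⁻¹' Set.pi univ t = Set.pi univ fun c => {x : α | ∀ j, e j = c → x ∈ t j} := by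
  ext s
  simp only [Set.mem_preimage, Set.mem_univ_pi, Set.mem_setOf_eq]
  constructor
  · rintro h c j rfl
    exact h j
  · intro h j
    exact h (e j) j rfl

/-- the product measure of that preimage, for `e` INJECTIVE: the `t j`-masses of the read coordinates times the total masses of the unread
ones. [folklore] -/
theorem pi_apply_preimage_proj [MeasurableSpace α] [Fintype C] [Fintype J] [DecidableEq C] (ν : C → Measure α)
    [∀ c, SigmaFinite (ν c)] {e : J → C} (he : Function.Injective e) (t : J → Set α) :
    Measure.pi ν ((fun (s : C → α) (j : J) => s (e j)) ⁻¹' Set.pi univ t) =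
      (∏ j, ν (e j) (t j)) * ∏ c ∈ (Finset.univ.image e)ᶜ, ν c univ := by
  rw [preimage_proj_univ_pi, Measure.pi_pi, ← Finset.prod_mul_prod_compl (Finset.univ.image e)]
  congr 1
  · rw [Finset.prod_image fun j _ j' _ h => he h]
    refine Finset.prod_congr rfl fun j _ => ?_
    congr 1
    ext x
    simp only [Set.mem_setOf_eq]
    exact ⟨fun h => h j rfl, fun h j' hj' => by obtain rfl := he hj'; exact h⟩
  · refine Finset.prod_congr rfl fun c hc => ?_
    have huniv : {x : α | ∀ j, e j = c → x ∈ t j} = univ := by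
      ext x
      simp only [Set.mem_setOf_eq, Set.mem_univ, iff_true]
      rintro j rfl
      exact absurd (Finset.mem_image_of_mem e (Finset.mem_univ j)) (Finset.mem_compl.1 hc)
    rw [huniv]

/-- **THE MARGINAL OF A FINITE PRODUCT MEASURE ALONG AN INJECTIVE COORDINATE MAP.**  For finite measures `ν_c` (`c : C`) and an injective
`e : J → C`, pushing `⊗_c ν_c` forward under `s ↦ (j ↦ s (e j))` gives `(∏_{c ∉ e(J)} ν_c(univ)) • ⊗_j ν_{e j}` — the read coordinates stay
independent with their own laws, the unread ones contribute their total mass.  (Mathlib `Measure.pi_map_eval` = one coordinate; the tree's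
`pi_map_proj_eq_pi` = iid probability measures.) [folklore] -/
theorem pi_map_proj_eq_smul_pi [MeasurableSpace α] [Fintype C] [Fintype J] [DecidableEq C] (ν : C → Measure α)
    [∀ c, IsFiniteMeasure (ν c)] {e : J → C} (he : Function.Injective e) :
    (Measure.pi ν).map (fun (s : C → α) (j : J) => s (e j)) =
      (∏ c ∈ (Finset.univ.image e)ᶜ, ν c univ) • Measure.pi fun j => ν (e j) := by
  have key : ∀ t : J → Set α, (∀ j, MeasurableSet (t j)) →
      (Measure.pi ν).map (fun (s : C → α) (j : J) => s (e j)) (Set.pi univ t) =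
        ((∏ c ∈ (Finset.univ.image e)ᶜ, ν c univ) • Measure.pi fun j => ν (e j)) (Set.pi univ t) := by
    intro t ht
    rw [Measure.map_apply (measurable_proj e) (MeasurableSet.univ_pi ht), pi_apply_preimage_proj ν he t,
      Measure.smul_apply, Measure.pi_pi, smul_eq_mul, mul_comm]
  refine ext_of_generate_finite _ generateFrom_pi.symm isPiSystem_pi ?_ ?_
  · rintro _ ⟨t, ht, rfl⟩
    exact key t fun j => ht j (Set.mem_univ j)
  · rw [← Set.pi_univ (univ : Set J)]
    exact key _ fun _ => MeasurableSet.univ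

end Proj

/-! ## §2 Normalised box averages agree along the projection -/

section Average

variable {α : Type*} [MeasurableSpace α] {C J : Type*} [Fintype C] [Fintype J] [DecidableEq C]

/-- integrating a function of the read coordinates against the big product measure = (mass of the unread coordinates) × its integral
against the small product measure. [folklore] -/
theorem integral_comp_proj_pi (ν : C → Measure α) [∀ c, IsFiniteMeasure (ν c)] {e : J → C} (he : Function.Injective e)
    {f : (J → α) → ℝ} (hf : AEStronglyMeasurable f (Measure.pi fun j => ν (e j))) :
    ∫ s, f (fun j => s (e j)) ∂(Measure.pi ν) =
      (∏ c ∈ (Finset.univ.image e)ᶜ, (ν c univ).toReal) * ∫ x, f x ∂(Measure.pi fun j => ν (e j)) := by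
  have hf' : AEStronglyMeasurable f ((Measure.pi ν).map fun (s : C → α) (j : J) => s (e j)) := by
    rw [pi_map_proj_eq_smul_pi ν he]
    exact hf.smul_measure _
  rw [← integral_map (measurable_proj e).aemeasurable hf', pi_map_proj_eq_smul_pi ν he, integral_smul_measure,
    ENNReal.toReal_prod, smul_eq_mul]

/-- **NORMALISED AVERAGES AGREE.**  With every coordinate of positive (finite) mass, the normalised average of `f ∘ (read along e)` over the
big box equals the normalised average of `f` over the small box. [folklore] -/
theorem average_comp_proj_pi (ν : C → Measure α) [∀ c, IsFiniteMeasure (ν c)] (hν : ∀ c, ν c univ ≠ 0) {e : J → C}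
    (he : Function.Injective e) {f : (J → α) → ℝ} (hf : AEStronglyMeasurable f (Measure.pi fun j => ν (e j))) :
    (∏ c, (ν c univ).toReal)⁻¹ * ∫ s, f (fun j => s (e j)) ∂(Measure.pi ν) =
      (∏ j, (ν (e j) univ).toReal)⁻¹ * ∫ x, f x ∂(Measure.pi fun j => ν (e j)) := by
  have hne : ∏ c ∈ (Finset.univ.image e)ᶜ, (ν c univ).toReal ≠ 0 :=
    Finset.prod_ne_zero_iff.2 fun c _ => ENNReal.toReal_ne_zero.2 ⟨hν c, measure_ne_top _ _⟩
  rw [integral_comp_proj_pi ν he hf, ← Finset.prod_mul_prod_compl (Finset.univ.image e) fun c => (ν c univ).toReal,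
    Finset.prod_image fun j _ j' _ h => he h, mul_inv, mul_assoc, inv_mul_cancel_left₀ hne]

end Average

/-! ## §3 A class-relative linear bound at almost every COMMON threshold vector passes to the normalised per-term averages -/

section Transport

variable {α : Type*} [MeasurableSpace α] {C : Type*} [Fintype C] [DecidableEq C]

/-- integrability transfers from the small box to the big box along the projection. [folklore] -/
theorem integrable_comp_proj_pi {J : Type*} [Fintype J] (ν : C → Measure α) [∀ c, IsFiniteMeasure (ν c)] {e : J → C}
    (he : Function.Injective e) {f : (J → α) → ℝ} (hf : Integrable f (Measure.pi fun j => ν (e j))) :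
    Integrable (fun s : C → α => f (fun j => s (e j))) (Measure.pi ν) := by
  have hf' : Integrable f ((Measure.pi ν).map fun (s : C → α) (j : J) => s (e j)) := by
    rw [pi_map_proj_eq_smul_pi ν he]
    exact hf.smul_measure (ENNReal.prod_ne_top fun c _ => measure_ne_top _ _)
  exact hf'.comp_measurable (measurable_proj e)

/-- averaging preserves linear inequalities between finite sums of TWO integrable families (file 5a's `integral_sum_le_of_forall` has one
family on both sides). [folklore] -/
theorem integral_sum_le_sum_of_forall {Λ : Type*} [MeasurableSpace Λ] {ι : Type*} (P : Measure Λ) (B T : Finset ι)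
    (g f : ι → Λ → ℝ) (W : ℝ) (hg : ∀ τ ∈ B, Integrable (g τ) P) (hf : ∀ τ ∈ T, Integrable (f τ) P)
    (h : ∀ᵐ l ∂P, ∑ τ ∈ B, g τ l ≤ W * ∑ τ ∈ T, f τ l) :
    ∑ τ ∈ B, ∫ l, g τ l ∂P ≤ W * ∑ τ ∈ T, ∫ l, f τ l ∂P := by
  rw [← integral_finsetSum B hg, ← integral_finsetSum T hf, ← integral_const_mul]
  exact integral_mono_ae (integrable_finsetSum B hg) ((integrable_finsetSum T hf).const_mul W) h

/-- **CLASS-RELATIVE TRANSPORT ON THE COMMON BOX.**  Coordinates `c : C` with finite laws `ν_c` of positive mass (the common box `⊗_c ν_c`);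
two finite families of terms `B`, `T`, term `τ` reading its `m τ` coordinates through an INJECTIVE `e τ : Fin (m τ) → C`, with sharp weights
`g τ` (on `B`) and `f τ` (on `T`), functions of the term's own threshold vector, integrable over the term's own box `⊗_j ν_{e τ j}`.  IF
`Σ_{τ ∈ B} g τ (S ∘ e τ) ≤ W · Σ_{τ ∈ T} f τ (S ∘ e τ)` for almost every COMMON vector `S`, THEN the same inequality holds between the sums of
the NORMALISED per-term box averages `(∏_j ν_{e τ j}(univ))⁻¹ · ∫ g τ ∂(⊗_j ν_{e τ j})` (§2 + `integral_sum_le_sum_of_forall`). [folklore] -/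
theorem sum_average_le_sum_of_forall_proj {ι : Type*} (ν : C → Measure α) [∀ c, IsFiniteMeasure (ν c)]
    (hν : ∀ c, ν c univ ≠ 0) (B T : Finset ι) {m : ι → ℕ} (e : (τ : ι) → Fin (m τ) → C)
    (heB : ∀ τ ∈ B, Function.Injective (e τ)) (heT : ∀ τ ∈ T, Function.Injective (e τ))
    (g f : (τ : ι) → (Fin (m τ) → α) → ℝ) (W : ℝ)
    (hg : ∀ τ ∈ B, Integrable (g τ) (Measure.pi fun j => ν (e τ j)))
    (hf : ∀ τ ∈ T, Integrable (f τ) (Measure.pi fun j => ν (e τ j)))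
    (h : ∀ᵐ S ∂(Measure.pi ν), ∑ τ ∈ B, g τ (fun j => S (e τ j)) ≤ W * ∑ τ ∈ T, f τ (fun j => S (e τ j))) :
    ∑ τ ∈ B, (∏ j, (ν (e τ j) univ).toReal)⁻¹ * ∫ x, g τ x ∂(Measure.pi fun j => ν (e τ j)) ≤
      W * ∑ τ ∈ T, (∏ j, (ν (e τ j) univ).toReal)⁻¹ * ∫ x, f τ x ∂(Measure.pi fun j => ν (e τ j)) := by
  have hM0 : 0 ≤ (∏ c, (ν c univ).toReal)⁻¹ := inv_nonneg.2 (Finset.prod_nonneg fun c _ => ENNReal.toReal_nonneg)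
  rw [Finset.sum_congr rfl fun τ hτ => (average_comp_proj_pi ν hν (heB τ hτ) (hg τ hτ).aestronglyMeasurable).symm,
    Finset.sum_congr rfl fun τ hτ => (average_comp_proj_pi ν hν (heT τ hτ) (hf τ hτ).aestronglyMeasurable).symm,
    ← Finset.mul_sum, ← Finset.mul_sum, mul_left_comm W]
  exact mul_le_mul_of_nonneg_left
    (integral_sum_le_sum_of_forall (Measure.pi ν) B T (fun τ S => g τ fun j => S (e τ j)) (fun τ S => f τ fun j => S (e τ j)) W
      (fun τ hτ => integrable_comp_proj_pi ν (heB τ hτ) (hg τ hτ)) (fun τ hτ => integrable_comp_proj_pi ν (heT τ hτ) (hf τ hτ)) h)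
    hM0

end Transport

/-! ## §4 The (η) face's `SiblingSuppression` from a SHARP class-relative sibling bound uniform over the common box -/

section Sibling

/-- under a product of interval-restricted Lebesgue measures, almost every vector lies in the box. [folklore] -/
theorem ae_mem_box_pi {n : ℕ} (lo hi : Fin n → ℝ) :
    ∀ᵐ S ∂(Measure.pi fun c : Fin n => (volume : Measure ℝ).restrict (Icc (lo c) (hi c))), ∀ c, S c ∈ Icc (lo c) (hi c) := by
  rw [← Measure.restrict_pi_pi]
  filter_upwards [ae_restrict_mem (MeasurableSet.univ_pi fun c => measurableSet_Icc)] with S hS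
  exact fun c => hS c (Set.mem_univ c)

variable {ι : Type*} {Ω : ℕ → ι → Type*} [∀ K τ, MeasurableSpace (Ω K τ)]
  {l₀ : ℝ} {T : ℕ → Finset ι} {X : ℕ → ℝ → ι → ℝ} {κ : ℕ → ℝ} {N : ℕ} {n : ℕ → ℕ}
  {μ : (K : ℕ) → (τ : ι) → Measure (Ω K τ)} [∀ K τ, SFinite (μ K τ)] {m : ℕ → ι → ℕ} {slot : ℕ → ι → ℕ → Σ _ : ℕ, ℕ}
  {pol : ℕ → ι → ℕ → Pol} {θ : ℕ → ι → ℕ → ℝ} {uX : (K : ℕ) → (τ : ι) → ℕ → Ω K τ → ℝ}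
  {RX : (K : ℕ) → ℝ → (τ : ι) → Ω K τ → ℝ} {ρ Ssup : ℕ → ℝ}
  {nC : ℕ → ℕ} {aC : ℕ → ℕ → ℕ} {θC : ℕ → ℕ → ℝ} {e : (K : ℕ) → (τ : ι) → Fin (m K τ) → Fin (nC K)}

/-- the sharp term weight, as a function of the term's threshold vector, is integrable over ANY interval box (file 5b's joint integrability,
marginalised). [folklore] -/
theorem integrable_Xs_box (Xs : (K : ℕ) → ℝ → (τ : ι) → (Fin (m K τ) → ℝ) → ℝ) {K : ℕ} {t : ℝ} {τ : ι}
    (meas : ∀ i < m K τ, Measurable (uX K τ i)) (rem_int : Integrable (RX K t τ) (μ K τ))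
    (hXs : ∀ s : Fin (m K τ) → ℝ,
      Xs K t τ s = ∫ v, (∏ i : Fin (m K τ), (pol K τ i).fac (smallInd (uX K τ i v) (s i))) * RX K t τ v ∂(μ K τ))
    (lo hi : Fin (m K τ) → ℝ) :
    Integrable (Xs K t τ) (Measure.pi fun j : Fin (m K τ) => (volume : Measure ℝ).restrict (Icc (lo j) (hi j))) := by
  have h := (integrable_sharpIntegrand (μ K τ) (fun i : Fin (m K τ) => pol K τ i) (u := fun i => uX K τ i)
    (fun i => meas i i.2) rem_int lo hi).integral_prod_left
  refine h.congr (ae_of_all _ fun s => ?_)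
  simp only [Function.uncurry_apply_pair]
  exact (hXs s).symm

/-- the sharp SIBLING weight of slot `σ`, as a function of the term's threshold vector, is integrable over ANY interval box (file 9's joint
integrability per factor, marginalised, summed). [folklore] -/
theorem integrable_Sbs_box (Sbs : (Σ _ : ℕ, ℕ) → (K : ℕ) → ℝ → (τ : ι) → (Fin (m K τ) → ℝ) → ℝ) {σ : Σ _ : ℕ, ℕ} {K : ℕ} {t : ℝ}
    {τ : ι} (meas : ∀ i < m K τ, Measurable (uX K τ i)) (rem_int : Integrable (RX K t τ) (μ K τ))
    (hSbs : ∀ s : Fin (m K τ) → ℝ,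
      Sbs σ K t τ s = ∑ i ∈ (Finset.range (m K τ)).filter (fun i => slot K τ i = σ),
          ∫ v, (pol K τ i).shell (uX K τ i v) (θ K τ i) (κ (slot K τ i).1) (ρ (K - (slot K τ i).1) * θ K τ i) *
            (∏ j : Fin (m K τ), (if (j : ℕ) = i then (1 : ℝ) else (pol K τ j).fac (smallInd (uX K τ j v) (s j)))) *
              RX K t τ v ∂(μ K τ))
    (lo hi : Fin (m K τ) → ℝ) :
    Integrable (Sbs σ K t τ) (Measure.pi fun j : Fin (m K τ) => (volume : Measure ℝ).restrict (Icc (lo j) (hi j))) := by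
  have h : ∀ i ∈ (Finset.range (m K τ)).filter (fun i => slot K τ i = σ),
      Integrable (fun s : Fin (m K τ) → ℝ =>
        ∫ v, (pol K τ i).shell (uX K τ i v) (θ K τ i) (κ (slot K τ i).1) (ρ (K - (slot K τ i).1) * θ K τ i) *
          (∏ j : Fin (m K τ), (if (j : ℕ) = i then (1 : ℝ) else (pol K τ j).fac (smallInd (uX K τ j v) (s j)))) * RX K t τ v ∂(μ K τ))
        (Measure.pi fun j : Fin (m K τ) => (volume : Measure ℝ).restrict (Icc (lo j) (hi j))) := by
    intro i hmem
    have him : i < m K τ := Finset.mem_range.1 (Finset.mem_filter.1 hmem).1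
    exact (integrable_sharpSiblingIntegrand (μ K τ) (fun j : Fin (m K τ) => pol K τ j) (u := fun j => uX K τ j)
      (fun j => meas j j.2) rem_int lo hi i (Pol.measurable_shell (meas i him) _ _ _ _) (fun v => Pol.shell_nonneg _ _ _ _ _)
      (fun v => Pol.shell_le_one _ _ _ _ _)).integral_prod_left
  refine (integrable_finsetSum _ h).congr (ae_of_all _ fun s => ?_)
  exact (hSbs s).symm

/-- **THE (η) FACE's `SiblingSuppression` FROM A SHARP CLASS-RELATIVE SIBLING BOUND UNIFORM OVER THE COMMON BOX.**  ONE run with data as in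
file 6's `n21_knit_sharpMixture` (per-term s-finite spaces, factor data `(m, slot, pol, θ)`, positive thresholds, measurable tested variables,
integrable threshold-free remainder, admissible widths `0 < κ_a`; the sharp weights `Xs` in the threshold-free representation `hXs` and the
carriers `X` PINNED as their normalised threshold averages `hX`; the sharp sibling weights `Sbs` of file 9, `hSbs`).  OCCURRENCE DATA per
step `K`: `nC K` occurrences of background-mediated characteristic functions, occurrence `c` of age `aC K c` and nominal threshold `θC K c > 0`;
term `τ ∈ T K` reads its `m K τ` factors at the occurrences `e K τ j`, `e K τ` INJECTIVE (a term never repeats an occurrence), consistently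
with its slots (`(slot K τ j).1 = aC K (e K τ j)`) and thresholds (`θ K τ j = θC K (e K τ j)`).  HYPOTHESIS `hsharp` (N20's, NE7b species, in
print's currency): for every slot `σ` of the window, every `K`, `|t| ≤ l₀` and EVERY threshold assignment `S` of the common box
`∏_c [(1 − κ_{aC K c})·θC K c, θC K c]` (one multiplier per OCCURRENCE, shared by all terms reading it),
`Σ_{τ ∈ T K} Sbs σ K t τ (S ∘ e K τ) ≤ Ssup σ.1 · Σ_{τ ∈ T K} Xs K t τ (S ∘ e K τ)`.  CONCLUSION: the N20 in-edge of files 6 ∕ 8,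
`SiblingSuppression l₀ T X N n (sibW (fun a => linProfile (κ a)) κ μ m slot pol θ uX RX ρ) Ssup`.  Proof: file 9's `sibW_eq_sharpMixture` and
`hX` put both sides in normalised-box-average form over the term's own box, which IS the marginal box of the common one along `e K τ`; §3.
CONDITIONAL on every displayed binder; nothing of Bałaban's asserted. [folklore] -/
theorem siblingSuppression_of_sharpCommonBox
    (Xs : (K : ℕ) → ℝ → (τ : ι) → (Fin (m K τ) → ℝ) → ℝ) (Sbs : (Σ _ : ℕ, ℕ) → (K : ℕ) → ℝ → (τ : ι) → (Fin (m K τ) → ℝ) → ℝ)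
    (hκ : ∀ a, 0 < κ a) (thr_pos : ∀ K, ∀ τ ∈ T K, ∀ i < m K τ, 0 < θ K τ i)
    (meas : ∀ K, ∀ τ ∈ T K, ∀ i < m K τ, Measurable (uX K τ i))
    (rem_int : ∀ K t, |t| ≤ l₀ → ∀ τ ∈ T K, Integrable (RX K t τ) (μ K τ))
    (hXs : ∀ K t, |t| ≤ l₀ → ∀ τ ∈ T K, ∀ s : Fin (m K τ) → ℝ,
      Xs K t τ s = ∫ v, (∏ i : Fin (m K τ), (pol K τ i).fac (smallInd (uX K τ i v) (s i))) * RX K t τ v ∂(μ K τ))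
    (hX : ∀ K t, |t| ≤ l₀ → ∀ τ ∈ T K, X K t τ =
      (∏ i : Fin (m K τ), (κ (slot K τ i).1 * θ K τ i))⁻¹ *
        ∫ s, Xs K t τ s ∂(Measure.pi fun i : Fin (m K τ) =>
          volume.restrict (Icc ((1 - κ (slot K τ i).1) * θ K τ i) (θ K τ i))))
    (hSbs : ∀ σ K t, |t| ≤ l₀ → ∀ τ ∈ T K, ∀ s : Fin (m K τ) → ℝ,
      Sbs σ K t τ s = ∑ i ∈ (Finset.range (m K τ)).filter (fun i => slot K τ i = σ),
          ∫ v, (pol K τ i).shell (uX K τ i v) (θ K τ i) (κ (slot K τ i).1) (ρ (K - (slot K τ i).1) * θ K τ i) *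
            (∏ j : Fin (m K τ), (if (j : ℕ) = i then (1 : ℝ) else (pol K τ j).fac (smallInd (uX K τ j v) (s j)))) *
              RX K t τ v ∂(μ K τ))
    (hθC : ∀ K c, 0 < θC K c) (he : ∀ K, ∀ τ ∈ T K, Function.Injective (e K τ))
    (he_age : ∀ K, ∀ τ ∈ T K, ∀ j : Fin (m K τ), (slot K τ j).1 = aC K (e K τ j))
    (he_thr : ∀ K, ∀ τ ∈ T K, ∀ j : Fin (m K τ), θ K τ j = θC K (e K τ j))
    (hsharp : ∀ σ ∈ (Finset.range (N + 1)).sigma (fun a => Finset.range (n a)), ∀ K t, |t| ≤ l₀ →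
      ∀ S : Fin (nC K) → ℝ, (∀ c : Fin (nC K), S c ∈ Icc ((1 - κ (aC K c)) * θC K c) (θC K c)) →
        ∑ τ ∈ T K, Sbs σ K t τ (fun j => S (e K τ j)) ≤ Ssup σ.1 * ∑ τ ∈ T K, Xs K t τ (fun j => S (e K τ j))) :
    SiblingSuppression l₀ T X N n (sibW (fun a => linProfile (κ a)) κ μ m slot pol θ uX RX ρ) Ssup := by
  intro σ hσ K t ht
  -- the common box of step `K`
  set ν : Fin (nC K) → Measure ℝ := fun c => (volume : Measure ℝ).restrict (Icc ((1 - κ (aC K c)) * θC K c) (θC K c)) with hν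
  have hmass : ∀ c, (ν c univ).toReal = κ (aC K c) * θC K c := by
    intro c
    have hle : 0 ≤ θC K c - (1 - κ (aC K c)) * θC K c := by nlinarith [hκ (aC K c), hθC K c]
    simp only [hν, Measure.restrict_apply MeasurableSet.univ, Set.univ_inter, Real.volume_Icc]
    rw [ENNReal.toReal_ofReal hle]
    ring
  have hν0 : ∀ c, ν c univ ≠ 0 := by
    intro c h0
    have h := hmass c
    rw [h0, ENNReal.toReal_zero] at h
    exact (mul_pos (hκ (aC K c)) (hθC K c)).ne' h.symm
  -- each term's own box IS the marginal box along its coordinate map, with the same normalisation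
  have hbox : ∀ τ ∈ T K,
      (Measure.pi fun i : Fin (m K τ) => (volume : Measure ℝ).restrict (Icc ((1 - κ (slot K τ i).1) * θ K τ i) (θ K τ i))) =
        Measure.pi fun j => ν (e K τ j) := by
    intro τ hτ
    congr 1
    funext j
    simp only [hν, he_age K τ hτ j, he_thr K τ hτ j]
  have hnorm : ∀ τ ∈ T K, (∏ i : Fin (m K τ), (κ (slot K τ i).1 * θ K τ i)) = ∏ j, (ν (e K τ j) univ).toReal := by
    intro τ hτ
    exact Finset.prod_congr rfl fun j _ => by rw [hmass, ← he_age K τ hτ j, ← he_thr K τ hτ j]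
  have hL : ∀ τ ∈ T K, sibW (fun a => linProfile (κ a)) κ μ m slot pol θ uX RX ρ σ K t τ =
      (∏ j, (ν (e K τ j) univ).toReal)⁻¹ * ∫ x, Sbs σ K t τ x ∂(Measure.pi fun j => ν (e K τ j)) := by
    intro τ hτ
    rw [sibW_eq_sharpMixture hκ K t τ (thr_pos K τ hτ) (meas K τ hτ) (rem_int K t ht τ hτ) σ, hnorm τ hτ, hbox τ hτ]
    congr 1
    exact integral_congr_ae (ae_of_all _ fun s => (hSbs σ K t ht τ hτ s).symm)
  have hR : ∀ τ ∈ T K, X K t τ = (∏ j, (ν (e K τ j) univ).toReal)⁻¹ * ∫ x, Xs K t τ x ∂(Measure.pi fun j => ν (e K τ j)) := by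
    intro τ hτ
    rw [hX K t ht τ hτ, hnorm τ hτ, hbox τ hτ]
  rw [Finset.sum_congr rfl hL, Finset.sum_congr rfl hR]
  -- integrability over the term boxes and the a.e. form of `hsharp`
  have hg : ∀ τ ∈ T K, Integrable (Sbs σ K t τ) (Measure.pi fun j => ν (e K τ j)) := fun τ hτ =>
    integrable_Sbs_box Sbs (meas K τ hτ) (rem_int K t ht τ hτ) (hSbs σ K t ht τ hτ) _ _
  have hf : ∀ τ ∈ T K, Integrable (Xs K t τ) (Measure.pi fun j => ν (e K τ j)) := fun τ hτ =>
    integrable_Xs_box Xs (meas K τ hτ) (rem_int K t ht τ hτ) (hXs K t ht τ hτ) _ _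
  have hae : ∀ᵐ S ∂(Measure.pi ν),
      ∑ τ ∈ T K, Sbs σ K t τ (fun j => S (e K τ j)) ≤ Ssup σ.1 * ∑ τ ∈ T K, Xs K t τ (fun j => S (e K τ j)) := by
    filter_upwards [ae_mem_box_pi (fun c : Fin (nC K) => (1 - κ (aC K c)) * θC K c) (fun c => θC K c)] with S hS
    exact hsharp σ hσ K t ht S hS
  exact sum_average_le_sum_of_forall_proj ν hν0 (T K) (T K) (e K) (he K) (he K) (fun τ => Sbs σ K t τ) (fun τ => Xs K t τ)
    (Ssup σ.1) hg hf hae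

end Sibling

end Summit.QuantumFields.YangMills.Theorems.N21ThresholdMixtureCommonBox

end
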